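import Summits.HubbardSuperconductivity.HubbardSuperconductivity.Theorems.AnisotropyChordInsertionEntropySheetSector

/-!
# Route `AnisotropyChord` / H0 rotor rung: the HALF-FILLED Jastrow–sheet rung statement and what it buys
# (port of theory seat `hubbard-h0-rotor-theory-1`, Sketch9 Part M, memo ROTOR-THEORY-9 §135(j)(l)(n)(p), tree currency)

* `halfSheetAmp L β` = the canonical half-filled (`N = ⌊L²/2⌋`) Jastrow–sheet Rokhsar–Kivelson state on `(ℤ/L)²`
  with `c = 0` (WLOG by `jastrowSectorAmp_sheet_indep`);
* **rung statement** `HalfFilledSheetScreening` (`∃ β₀ > 0, ∀ β ∈ (0, β₀]: SheetDefectScreeningC β 0 (L ↦ L²/2)`; OPEN)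
  and its PROVED consequences `condensate_of_halfFilledSheetScreening'` (every `L ≥ 2`) /
  `condensate_of_halfFilledSheetScreening_even` (even `L ≥ 2`: `e^{−C/2}/4 ≤ n₀/|Λ|`, uniform BEC at half filling);
* the typed analytic targets S2 of the screening proof plan (STATEMENTS ONLY, nothing claimed): `sheetKernelHat`,
  S2(a) `SheetKernelSpectralFloor`, S2(b) `SheetKernelSmallK`, the Debye–Hückel propagator `dhPropagatorHat` /
  `dhPropagator` and S2(c) `LatticeDHPropagatorDecay`.
-/

set_option linter.dupNamespace false

noncomputable section

open Finset
open Literature.Probability.LatticeModels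

namespace Summit.HubbardSuperconductivity.HubbardSuperconductivity.Theorems.AnisotropyChord.InsertionEntropy

section SheetRung

/-- The canonical HALF-FILLED Jastrow–sheet state on `(ℤ/L)²`: `N = ⌊L²/2⌋` particles, pair potential `β/d`,
diagonal `c = 0` (immaterial by `jastrowSectorAmp_sheet_indep`). (theory seat Sketch9 Part N `halfSheetAmp`) [folklore] -/
def halfSheetAmp (L : ℕ) [NeZero L] (β : ℝ) : (TorusSite 2 L → Fin 2) → ℝ :=
  jastrowSectorAmp (sheetKernel L β 0) (L ^ 2 / 2)

/-- **THE RUNG STATEMENT `HalfFilledSheetScreening` (OPEN):** screening of the half-filled Jastrow sheet at weak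
coupling — there is `β₀ > 0` such that for all `0 < β ≤ β₀` the canonical two-defect cloud of the half-filled
lattice `β/r` sheet gas obeys pointwise algebraic screening `SheetDefectScreeningC β 0 (L ↦ L²/2)`.
[conjecture: theory seat hubbard-h0-rotor-theory-1, cycle 9, 2026-08-28 — Sketch9 Part M, memo ROTOR-THEORY-9 §135(j)(3) (OPEN); proof plan S1–S4 ibid., S3 = sine-Gordon/Debye screening expansion of Brydges 1978 / Imbrie 1983 type with an algebraically screened sheet covariance] -/
def HalfFilledSheetScreening : Prop :=
  ∃ β₀ : ℝ, 0 < β₀ ∧ ∀ β : ℝ, 0 < β → β ≤ β₀ → SheetDefectScreeningC β 0 (fun L => L ^ 2 / 2)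

/-- **What the rung buys (PROVED from ★′):** a UNIFORM condensate floor
`n₀/|Λ| ≥ (⌊L²/2⌋/L²)(1 − ⌊L²/2⌋/L²)·e^{−C/2}` for the half-filled Jastrow–sheet state, every `L ≥ 2`, every
`0 < β ≤ β₀` (`C = C(β)` independent of `L`). (theory seat Sketch9 Part M `condensate_of_halfFilledSheetScreening'`) [folklore] -/
theorem condensate_of_halfFilledSheetScreening' (h : HalfFilledSheetScreening) :
    ∃ β₀ : ℝ, 0 < β₀ ∧ ∀ β : ℝ, 0 < β → β ≤ β₀ → ∃ C : ℝ, ∀ L : ℕ, ∀ [NeZero L], 2 ≤ L →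
      ((L ^ 2 / 2 : ℕ) / (L : ℝ) ^ 2) * (1 - (L ^ 2 / 2 : ℕ) / (L : ℝ) ^ 2) * Real.exp (-C / 2)
        ≤ condensateDensity (halfSheetAmp L β) := by
  obtain ⟨β₀, hβ₀, h⟩ := h
  refine ⟨β₀, hβ₀, fun β hβ hβ' => ?_⟩
  obtain ⟨C, hC⟩ := condensateDensity_sheetSector_ge_of_defectC' β 0 (fun L => L ^ 2 / 2) (h β hβ hβ')
  refine ⟨C, fun L _ hL => ?_⟩
  have hsq : 4 ≤ L ^ 2 := by nlinarith
  exact hC L (by omega) (by omega)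

/-- **Even `L`: the floor is exactly `e^{−C/2}/4 ≤ n₀/|Λ|`** — Bose–Einstein condensation of the half-filled
Jastrow–sheet Rokhsar–Kivelson state, uniformly in even `L ≥ 2`, for every `0 < β ≤ β₀`, GIVEN the rung.
(theory seat Sketch9 Part M `condensate_of_halfFilledSheetScreening_even`) [folklore] -/
theorem condensate_of_halfFilledSheetScreening_even (h : HalfFilledSheetScreening) :
    ∃ β₀ : ℝ, 0 < β₀ ∧ ∀ β : ℝ, 0 < β → β ≤ β₀ → ∃ C : ℝ, ∀ L : ℕ, ∀ [NeZero L], 2 ≤ L → Even L →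
      Real.exp (-C / 2) / 4 ≤ condensateDensity (halfSheetAmp L β) := by
  obtain ⟨β₀, hβ₀, h⟩ := condensate_of_halfFilledSheetScreening' h
  refine ⟨β₀, hβ₀, fun β hβ hβ' => ?_⟩
  obtain ⟨C, hC⟩ := h β hβ hβ'
  refine ⟨C, fun L _ hL hev => ?_⟩
  have key := hC L hL
  obtain ⟨m, hm⟩ := hev
  have hLm : L = 2 * m := by omega
  have hdiv : L ^ 2 / 2 = 2 * m ^ 2 := by
    subst hLm
    have : (2 * m) ^ 2 = 2 * (2 * m ^ 2) := by ring
    rw [this, Nat.mul_div_cancel_left _ (by norm_num : 0 < 2)]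
  have hratio : ((L ^ 2 / 2 : ℕ) : ℝ) / (L : ℝ) ^ 2 = 1 / 2 := by
    rw [hdiv, hLm]; push_cast
    have hm0 : (0 : ℝ) < (m : ℝ) := by
      have : 0 < m := by omega
      exact_mod_cast this
    field_simp
  rw [hratio] at key
  have : (1 / 2 : ℝ) * (1 - 1 / 2) * Real.exp (-C / 2) = Real.exp (-C / 2) / 4 := by ring
  linarith [this ▸ key]

/-! ### Typed analytic targets S2 of the screening proof plan (statements only; memo §135(j),(n)) -/

/-- Lattice Fourier transform `Ŵ_L(k) = Re Σ_z W_L(z) e^{ik·z}` of the sheet kernel with `c = 0` (the kernel is even, so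
this is `Σ_z W_L(z) cos(k·z)`). (theory seat Sketch9 Part M) [folklore] -/
def sheetKernelHat (L : ℕ) [NeZero L] (β : ℝ) (k : TorusSite 2 L) : ℝ :=
  (kernelFT L (sheetFun L β 0) k).re

/-- **S2(a) `SheetKernelSpectralFloor w₀` (typed target, OPEN):** `Ŵ_L(k) ≥ −w₀ β` uniformly in `L` and `k`
(numerically `min_k Ŵ_L(k) = Ŵ_L(π,π) = −1.6155·β`, `L = 8 … 64`; the free diagonal shift of the Debye–Hückel split).
[conjecture: theory seat hubbard-h0-rotor-theory-1, cycle 9, 2026-08-28 — Sketch9 Part M, memo ROTOR-THEORY-9 §135(j)(1) (typed target; certified lattice sum, OPEN)] -/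
def SheetKernelSpectralFloor (w₀ : ℝ) : Prop :=
  ∀ (L : ℕ) [NeZero L] (β : ℝ), 0 ≤ β → ∀ k : TorusSite 2 L, -(w₀ * β) ≤ sheetKernelHat L β k

/-- **S2(b) `SheetKernelSmallK k₀ c₁ c₂` (typed target, OPEN):** two-sided sheet law at small wave number,
`c₁ β ≤ |k|_T Ŵ_L(k) ≤ c₂ β` for `0 < |k|_T ≤ k₀` (two-sided, NOT an asymptotic law with vanishing relative error:
at the fixed lowest modes the min-image truncation converges to cell integrals `≠ 1`; memo §135(n)).
[conjecture: theory seat hubbard-h0-rotor-theory-1, cycle 9, 2026-08-28 — Sketch9 Part M, memo ROTOR-THEORY-9 §135(n) (typed target, OPEN)] -/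
def SheetKernelSmallK (k₀ c₁ c₂ : ℝ) : Prop :=
  ∀ (L : ℕ) [NeZero L] (β : ℝ), 0 ≤ β → ∀ k : TorusSite 2 L, k ≠ 0 → torusNorm L k ≤ k₀ →
    c₁ * β ≤ torusNorm L k * sheetKernelHat L β k ∧ torusNorm L k * sheetKernelHat L β k ≤ c₂ * β

/-- Debye wave number of the half-filled sheet, `k_s = 2πβ·χ₀ = πβ/2` (`χ₀ = ρ(1−ρ) = ¼`). (theory seat Sketch9 Part M) [folklore] -/
def debyeWavenumber (β : ℝ) : ℝ := Real.pi * β / 2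

/-- Debye–Hückel (Gaussian) propagator of the lattice cos-Gordon field in Fourier space with the free diagonal shift
`w₀`: `Ĝ(k) = g/(1+g)`, `g = (Ŵ_L(k) + β w₀)/4`. (theory seat Sketch9 Part M) [folklore] -/
def dhPropagatorHat (L : ℕ) [NeZero L] (β w₀ : ℝ) (k : TorusSite 2 L) : ℝ :=
  ((sheetKernelHat L β k + β * w₀) / 4) / (1 + (sheetKernelHat L β k + β * w₀) / 4)

/-- Real-space Debye–Hückel propagator `G_L(r) = L⁻² Σ_k Ĝ(k) cos(k·r)`. (theory seat Sketch9 Part M) [folklore] -/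
def dhPropagator (L : ℕ) [NeZero L] (β w₀ : ℝ) (r : TorusSite 2 L) : ℝ :=
  (∑ k, dhPropagatorHat L β w₀ k * (torusPhase L k r).re) / (L : ℝ) ^ 2

/-- **S2(c) `LatticeDHPropagatorDecay w₀ β₀ C` (typed target, OPEN):** uniform decay of the lattice DH propagator,
`|G_L(r)| ≤ (C/β)(1 + d(r))⁻²` for `0 < β ≤ β₀`, uniformly in `L` (exponent `2`, not `3`: the min-image kernel has an
antipodal seam; memo §135(n)).
[conjecture: theory seat hubbard-h0-rotor-theory-1, cycle 9, 2026-08-28 — Sketch9 Part M, memo ROTOR-THEORY-9 §135(n) (typed target, OPEN)] -/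
def LatticeDHPropagatorDecay (w₀ β₀ C : ℝ) : Prop :=
  ∀ (L : ℕ) [NeZero L] (β : ℝ), 0 < β → β ≤ β₀ → ∀ r : TorusSite 2 L,
    |dhPropagator L β w₀ r| ≤ C / β * latWeight L 2 r

end SheetRung

end Summit.HubbardSuperconductivity.HubbardSuperconductivity.Theorems.AnisotropyChord.InsertionEntropy
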